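import Summits.CriticalPhenomena.SAWScalingLimit.Theses.SAWPoissonBanks
import Literature.Probability.RandomPlanarGeometry.ConformalRestrictionHolds
import HarnessLib

/-!
# `LSWSimpleRestrictionIsSLE` (item stmt-CriticalPhenomena-3017) — proved

The support item `LSWSimpleRestrictionIsSLE` of route `SAWPoissonBanks` (shared with the sibling
route decls named `LSWRestrictionFact83` / `LSWSimpleRestriction`) is, after unfolding
`ChordalFamily.IsConformallyCovariant` and `ChordalFamily.IsRestriction` (both `Iff.rfl`),
literally the tree's named fact `Literature.Probability.RandomPlanarGeometry.LawlerSchrammWerner2003`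
([LSW03] p. 5 result 2: a chordal, conformally covariant family with two-sided restriction carried
by simple curves is chordal SLE_{8/3}), which is DISCHARGED in the tree by
`Literature.Probability.RandomPlanarGeometry.LawlerSchrammWerner2003_holds`
(`ConformalRestrictionHolds.lean`). The proof is the one-line application.

## References

* G. F. Lawler, O. Schramm, W. Werner, *Conformal restriction: the chordal case*,
  J. Amer. Math. Soc. 16 (2003), arXiv:math/0209343, p. 5 result 2; Prop. 3.3, Thm. 6.1, Cor. 8.6.
  [LawlerSchrammWerner2003Restriction]
-/

namespace Summit.CriticalPhenomena.SAWScalingLimit.Theorems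

open Literature.Probability.RandomPlanarGeometry

/-- **Item stmt-CriticalPhenomena-3017** (`LSWSimpleRestrictionIsSLE`, route SAWPoissonBanks):
a chordal family on Dobrushin domains that is chordal, conformally covariant, has the two-sided
restriction property and is carried by simple curves meeting `∂D` only at the two marked points is,
in every domain, the chordal SLE_{8/3} law. Immediate from the discharged Literature fact
`LawlerSchrammWerner2003_holds` ([LSW03] p. 5 result 2). -/
theorem LSWSimpleRestrictionIsSLE_proof :
    Summit.CriticalPhenomena.SAWScalingLimit.Theses.SAWPoissonBanks.LSWSimpleRestrictionIsSLE := by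
  unfold Summit.CriticalPhenomena.SAWScalingLimit.Theses.SAWPoissonBanks.LSWSimpleRestrictionIsSLE
  intro P hch hcov hres hsimple
  exact LawlerSchrammWerner2003_holds P hch hcov hres hsimple

end Summit.CriticalPhenomena.SAWScalingLimit.Theorems
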